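import Mathlib
import HarnessLib
import Summits.Ventures.LatticeQCDFlow.Scoring.SU3TwoRowReconstruction

/-!
# The Gram–Schmidt reunitarisation of an `SU(3)` link lands in `SU(3)` exactly: normalise row 0, orthogonalise and normalise row 1, rebuild row 2 as the conjugate cross product

HONEST FRAMING: exact (Metropolis-corrected) sampling algorithms for lattice gauge theory;
figures of merit are autocorrelation/cost numbers at stated couplings and volumes; no
continuum-physics claim.

Venture `LatticeQCDFlow` (cell pub-lqcd), sub-topic `Scoring`; FANOUT row 21 (`su3-base`: the 4D
`SU(3)` baselines; the drivers' periodic reunitarisation of accumulated links, CARD §13).  NEW WORK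
of the cell (placement rule), elementary, over row 21 GEN-8's `Scoring/SU3TwoRowReconstruction`
(`reconstruct_mem_specialUnitaryGroup`: `[u; v; conj(u × v)] ∈ SU(3)` for Hermitian-orthonormal
`u, v`).  No definition is introduced; nothing is cited as a fact; no number of ours.  NAMED ONLY:
the standard "reunitarize" routine of `SU(3)` codes (normalise the first row, Gram–Schmidt the
second against it, third row = conjugate cross product).

In exact arithmetic the routine applied to ANY two rows `u ≠ 0`, `v ∉ ℂu` produces a matrix in
`SU(3)`: with `u' = u/|u|`, `v₁ = v − ⟨v, u'⟩ u'`, `v' = v₁/|v₁|`, the pair `u', v'` is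
Hermitian-orthonormal, so `[u'; v'; conj(u' × v')] ∈ SU(3)`.  (When the input already is an `SU(3)`
matrix the routine returns it unchanged — its rows are orthonormal and its third row IS the
conjugate cross product, `Scoring/SU3TwoRowReconstruction.su3_row_two_eq_star_cross`.)

## What is proved (`u v : Fin 3 → ℂ`, Hermitian pairing `a ⬝ᵥ star b`)

* `dotProduct_star_self_eq` — `u ⬝ ū = Σᵢ |uᵢ|²` (a real number, cast); `sum_normSq_pos_of_ne_zero`;
* `normalise_dotProduct_star_self` — `u' ⬝ ū' = 1` for `u' = (Σ|uᵢ|²)^{-1/2} • u`, `u ≠ 0`;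
* `orthogonalise_dotProduct_star` — `(v − (v ⬝ ū') • u') ⬝ ū' = 0` when `u' ⬝ ū' = 1`;
* **`gramSchmidt_reconstruct_mem_specialUnitaryGroup`** — for `u ≠ 0` and
  `v₁ = v − (v ⬝ ū')•u' ≠ 0`, the matrix `[u'; v'; conj(u' × v')]` lies in `SU(3)`.

NOT CLAIMED: any floating-point statement; optimality (the routine is not the nearest-`SU(3)`
projection — that is the polar/Procrustes map of the Literature's `UnitaryProcrustes`).
-/

namespace Summit.Ventures.LatticeQCDFlow.Scoring

open Matrix

section GramSchmidt

/-- `u ⬝ ū = Σᵢ |uᵢ|²` (as a complex number). -/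
theorem dotProduct_star_self_eq (u : Fin 3 → ℂ) :
    u ⬝ᵥ star u = ((∑ i, ‖u i‖ ^ 2 : ℝ) : ℂ) := by
  rw [dotProduct, Complex.ofReal_sum]
  refine Finset.sum_congr rfl fun i _ => ?_
  rw [Pi.star_apply, Complex.star_def, Complex.mul_conj, Complex.normSq_eq_norm_sq, Complex.ofReal_pow]

/-- A non-zero vector has positive `Σᵢ |uᵢ|²`. -/
theorem sum_normSq_pos_of_ne_zero {u : Fin 3 → ℂ} (hu : u ≠ 0) : 0 < ∑ i, ‖u i‖ ^ 2 := by
  obtain ⟨i, hi⟩ : ∃ i, u i ≠ 0 := Function.ne_iff.mp hu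
  have hle : ‖u i‖ ^ 2 ≤ ∑ j, ‖u j‖ ^ 2 :=
    Finset.single_le_sum (f := fun j => ‖u j‖ ^ 2) (fun j _ => sq_nonneg _) (Finset.mem_univ i)
  have hpos : 0 < ‖u i‖ ^ 2 := by positivity
  linarith

/-- **Normalisation**: `u' = (Σ|uᵢ|²)^{-1/2} • u` has `u' ⬝ ū' = 1` (`u ≠ 0`). -/
theorem normalise_dotProduct_star_self {u : Fin 3 → ℂ} (hu : u ≠ 0) :
    ((((Real.sqrt (∑ i, ‖u i‖ ^ 2))⁻¹ : ℝ) : ℂ) • u) ⬝ᵥ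
        star ((((Real.sqrt (∑ i, ‖u i‖ ^ 2))⁻¹ : ℝ) : ℂ) • u) = 1 := by
  set N : ℝ := ∑ i, ‖u i‖ ^ 2 with hN
  have hNpos : 0 < N := sum_normSq_pos_of_ne_zero hu
  have hsq : Real.sqrt N ^ 2 = N := Real.sq_sqrt hNpos.le
  have hsq0 : Real.sqrt N ≠ 0 := (Real.sqrt_pos.mpr hNpos).ne'
  rw [star_smul, smul_dotProduct, dotProduct_smul, dotProduct_star_self_eq, ← hN, Complex.star_def,
    Complex.conj_ofReal, smul_eq_mul, smul_eq_mul]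
  have h : (((Real.sqrt N)⁻¹ : ℝ) : ℂ) * ((((Real.sqrt N)⁻¹ : ℝ) : ℂ) * (N : ℂ)) =
      ((((Real.sqrt N)⁻¹ * ((Real.sqrt N)⁻¹ * N) : ℝ)) : ℂ) := by push_cast; ring
  rw [h]
  have h2 : (Real.sqrt N)⁻¹ * ((Real.sqrt N)⁻¹ * N) = 1 := by
    rw [← mul_assoc, ← mul_inv, ← pow_two, hsq, inv_mul_cancel₀ hNpos.ne']
  rw [h2, Complex.ofReal_one]

/-- **Orthogonalisation**: if `u' ⬝ ū' = 1` then `(v − (v ⬝ ū') • u') ⬝ ū' = 0`. -/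
theorem orthogonalise_dotProduct_star {u' v : Fin 3 → ℂ} (hu : u' ⬝ᵥ star u' = 1) :
    (v - (v ⬝ᵥ star u') • u') ⬝ᵥ star u' = 0 := by
  rw [sub_dotProduct, smul_dotProduct, hu, smul_eq_mul, mul_one, sub_self]

/-- **The Gram–Schmidt reunitarisation lands in `SU(3)`**: for `u ≠ 0` and
`v₁ = v − (v ⬝ ū') • u' ≠ 0` (i.e. `v ∉ ℂ u`), with `u' = u/|u|`, `v' = v₁/|v₁|`, the matrix
`[u'; v'; conj(u' × v')]` is special unitary. -/
theorem gramSchmidt_reconstruct_mem_specialUnitaryGroup {u v : Fin 3 → ℂ} (hu : u ≠ 0)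
    (hv : v - (v ⬝ᵥ star ((((Real.sqrt (∑ i, ‖u i‖ ^ 2))⁻¹ : ℝ) : ℂ) • u)) •
      ((((Real.sqrt (∑ i, ‖u i‖ ^ 2))⁻¹ : ℝ) : ℂ) • u) ≠ 0) :
    let u' : Fin 3 → ℂ := (((Real.sqrt (∑ i, ‖u i‖ ^ 2))⁻¹ : ℝ) : ℂ) • u
    let v₁ : Fin 3 → ℂ := v - (v ⬝ᵥ star u') • u'
    let v' : Fin 3 → ℂ := (((Real.sqrt (∑ i, ‖v₁ i‖ ^ 2))⁻¹ : ℝ) : ℂ) • v₁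
    (Matrix.of ![u', v', star (u' ⨯₃ v')] : Matrix (Fin 3) (Fin 3) ℂ) ∈
      Matrix.specialUnitaryGroup (Fin 3) ℂ := by
  intro u' v₁ v'
  have hu' : u' ⬝ᵥ star u' = 1 := normalise_dotProduct_star_self hu
  have hv₁ : v₁ ⬝ᵥ star u' = 0 := orthogonalise_dotProduct_star hu'
  have hv₁ne : v₁ ≠ 0 := hv
  have hv' : v' ⬝ᵥ star v' = 1 := normalise_dotProduct_star_self hv₁ne
  have hv'u : v' ⬝ᵥ star u' = 0 := by
    change ((((Real.sqrt (∑ i, ‖v₁ i‖ ^ 2))⁻¹ : ℝ) : ℂ) • v₁) ⬝ᵥ star u' = 0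
    rw [smul_dotProduct, hv₁, smul_zero]
  have hu'v : u' ⬝ᵥ star v' = 0 := by
    rw [dotProduct_star, hv'u, star_zero]
  exact reconstruct_mem_specialUnitaryGroup hu' hv' hu'v

end GramSchmidt

end Summit.Ventures.LatticeQCDFlow.Scoring
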